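import Summits.HodgeConjecture.CorCM.MultiFieldWeilUnitsSeparated
import Summits.HodgeConjecture.CorCM.MultiFieldWeilUnitsMenuFree
import HarnessLib

/-!
# MULTI-FIELD WEIL ENGINE — THE RANKED DEFECT LAW WITH SEPARATED UNITS: D2's ranked transfer (movers only downwards; decoupling below `2`-transitive units) with the
# per-unit separation supplied ABSTRACTLY, so that dihedral decic units can be MIXED with the sextic ∕ octic ∕ `2`-transitive decic menu (census, realised, frame headline)

Cell `pub-hodgecm2` (COR-CM), seat b30 gen 42 (2026-08-26); count-neutral own lane MULTI-FIELD WEIL ENGINE (stem `MultiFieldWeil*`), the ranked analogue of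
`CorCM/MultiFieldWeilUnitsSeparated.lean` (E4): D2 `exists_hasDefectsG_of_unitsRanked` (`CorCM/MultiFieldWeilRankedTransfer.lean`) and D3's frame headline
`hodgeConjectureFor_biproduct_comp_of_unitsRanked_frames` (`CorCM/MultiFieldWeilUnitsMenuFree.lean` §1) with the hypotheses `h2t` + `hli` (U1's separation over a `2`-transitive
image) REPLACED by the abstract separation property `hunit` of E4; the proof is D2's verbatim (transfer balancedness to the unit-wise product `R'`, where movers are free) followed by
E4 on `R'` (a unit separated over `R` is separated over `R' ⊇ R`).  §4 `unit_separated_of_twoTransitive`: the old hypotheses `h2t` + `hli` GIVE `hunit` (U1 read through the image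
of `R` at the slot), so `2`-transitive units (sextic twins, `𝔄₄`/`𝔖₄`-octic triples, `2`-transitive decic quadruples) and DIHEDRAL decic units
(`const_of_signed_realisedTuples_of_dihedral(_meet)`) can be fed to ONE engine — the merged menu is the successor's generator pass over `CorCM/MultiFieldWeilUnitsMenuIntermediate.lean`.
Theorems only; no definition, no named fact, no `sorry`.  HONEST FRAMING: the headline concludes the Hodge conjecture for products of copies GIVEN the single-slot Weil spaces `hW`;
`HC_CM` is NOT asserted.
[cite: Serre1977, §2.2 Cor. 2–3 of Prop. 4; §2.3 Ex. 2.6] [cite: MoonenZarhin1995Duke, Thm. 2.4] [cite: Pohlmann1968, Thm 1] [cite: GaoUllmo2025, Thm 3.1] [cite: Shimura1998, §18.2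
Lemma (i)] [cite: DixonMortimer1996, §1.4 Ex. 1.4.1–1.4.2; §1.6, Thm. 1.6A; §2.1] [cite: Lang2002, XIII §4] [cite: Milne2020HodgeClassesAV, 1.2 (a) and Thm. 1]

## References
* [Serre1977] J.-P. Serre, *Linear Representations of Finite Groups*, GTM 42, §2.2–2.3.  [MoonenZarhin1995Duke] B. Moonen, Yu. Zarhin, Duke Math. J. 77 (1995), Thm. 2.4.
  [Pohlmann1968] H. Pohlmann, Ann. of Math. 88 (1968), Thm 1.  [GaoUllmo2025] Z. Gao, E. Ullmo, J. Inst. Math. Jussieu 25 (2025), Thm 3.1.  [Shimura1998] G. Shimura, *Abelian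
  varieties with complex multiplication and modular functions*, §18.2.  [DixonMortimer1996] J. D. Dixon, B. Mortimer, *Permutation Groups*, GTM 163.  [Lang2002] S. Lang,
  *Algebra*, GTM 211, XIII §4.  [Milne2020HodgeClassesAV] J. S. Milne, arXiv:2010.08857, 1.2 (a), Thm. 1.
-/

noncomputable section

open CategoryTheory CategoryTheory.Limits NumberField IntermediateField

namespace Summit.HodgeConjecture.CorCM.MultiFieldWeil

open Finset
open Literature.AlgebraicGeometry Literature.AlgebraicGeometry.Motives Literature.AlgebraicGeometry.HodgeTheory
open Literature.AlgebraicGeometry.ComplexMultiplication (IsCMTypeRealisation)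
open Literature.AlgebraicTopology.SingularHomology
open Literature.NumberTheory.ComplexMultiplication
open Summit.HodgeConjecture.CorCM.Census.MultiFieldWeil

open scoped Classical

/-! ## §1 The ranked defect law with separated units (census) -/

section Model

variable {r : ℕ} {n : Fin r → ℕ} {R : Finset (PermsG n)} {P : ∀ m : Fin r, Finset (Fin (n m))}

/-- **THE DEFECT LAW WITH RANKED, SEPARATED UNITS** (census).  D2 with `h2t` + `hli` replaced by the abstract per-unit separation `hunit`; see the module docstring.
[cite: Serre1977, §2.2 Cor. 2–3 of Prop. 4; §2.3 Ex. 2.6] [cite: MoonenZarhin1995Duke, Thm. 2.4] [cite: GaoUllmo2025, Thm 3.1] [cite: DixonMortimer1996, §1.4 Ex. 1.4.1–1.4.2; §1.6,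
Thm. 1.6A; §2.1] [cite: Lang2002, XIII §4] -/
theorem exists_hasDefectsG_of_unitsRankedSeparated (hmul : ∀ π ∈ R, ∀ π' ∈ R, π * π' ∈ R) (hinv : ∀ π ∈ R, π⁻¹ ∈ R) (hne : R.Nonempty)
    (htrans : ∀ (m : Fin r) (a a' : Fin (n m)), ∃ π ∈ R, π m a = a')
    (U : Fin r → Fin r) (hn : ∀ m m' : Fin r, U m' = U m → n m' = n m)
    (hdiag : ∀ π ∈ R, ∀ (m m' : Fin r) (h : U m' = U m) (a : Fin (n m')), Fin.cast (hn m m' h) (π m' a) = π m (Fin.cast (hn m m' h) a))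
    (rk : Fin r → ℕ) (hrk : ∀ m m' : Fin r, U m' = U m → rk m' = rk m)
    (hpair : ∀ m₀ m : Fin r, U m ≠ U m₀ → rk m ≤ rk m₀ →
      (∀ a a' : Fin (n m), ∃ ν ∈ R, (∀ m', U m' = U m₀ → ν m' = 1) ∧ ν m a = a') ∨
      (∀ m', U m' = U m₀ → (∀ a a' b b' : Fin (n m'), a ≠ a' → b ≠ b' → ∃ π ∈ R, π m' a = b ∧ π m' a' = b') ∧ n m < n m'))
    (hkind : ∀ m, (∀ m', U m' = U m → m' = m) → ((n m).Prime ∧ (P m).Nonempty ∧ (P m).card < n m) ∨ (P m).card = 1 ∨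
      ((0 < (P m).card ∧ (P m).card < n m) ∧ ∀ Q : Finset (Fin (n m)), Q.card = (P m).card → ∃ π ∈ R, preG (π m) (P m) = Q))
    (hunit : ∀ m, (∃ m', m' ≠ m ∧ U m' = U m) → ∀ (u : {m' : Fin r // U m' = U m} → Fin (n m) → ℤ) (w : ℤ),
      (∀ π ∈ R, (∑ i, ∑ x : Fin (n m), (if π m x ∈ (P i.1).image (Fin.cast (hn m i.1 i.2)) then u i x else -u i x)) = w) →
      ∀ (i : {m' : Fin r // U m' = U m}) (a b : Fin (n m)), u i a = u i b)
    (c : Fin r → ℕ) (hc : ∀ m, ((c m : ℕ) : ℤ) = (n m : ℤ) - 2 * (P m).card)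
    {α : Type} (v : α → PtG n) (T : Finset α) (hT : ModelBalancedG P R v T) : ∃ t : Fin r → ℤ, HasDefectsG c v T t := by
  have h1R : (1 : PermsG n) ∈ R := one_mem_of_closed hmul hinv hne
  -- the unit-wise product `R'`
  set R' : Finset (PermsG n) := Finset.univ.filter fun π' => ∀ m₀, ∃ π ∈ R, ∀ m, U m = U m₀ → π m = π' m with hR'
  have hmemR' : ∀ π' : PermsG n, π' ∈ R' ↔ ∀ m₀, ∃ π ∈ R, ∀ m, U m = U m₀ → π m = π' m := fun π' => by simp [hR']
  have hRR' : R ⊆ R' := fun π hπ => (hmemR' π).2 fun m₀ => ⟨π, hπ, fun _ _ => rfl⟩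
  have hmul' : ∀ π ∈ R', ∀ π' ∈ R', π * π' ∈ R' := fun π₁ h₁ π₂ h₂ => (hmemR' _).2 fun m₀ => by
    obtain ⟨ρ₁, hρ₁, e₁⟩ := (hmemR' π₁).1 h₁ m₀
    obtain ⟨ρ₂, hρ₂, e₂⟩ := (hmemR' π₂).1 h₂ m₀
    exact ⟨ρ₁ * ρ₂, hmul _ hρ₁ _ hρ₂, fun m hm => by rw [Pi.mul_apply, Pi.mul_apply, e₁ m hm, e₂ m hm]⟩
  have hinv' : ∀ π ∈ R', π⁻¹ ∈ R' := fun π₁ h₁ => (hmemR' _).2 fun m₀ => by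
    obtain ⟨ρ, hρ, e⟩ := (hmemR' π₁).1 h₁ m₀
    exact ⟨ρ⁻¹, hinv _ hρ, fun m hm => by rw [Pi.inv_apply, Pi.inv_apply, e m hm]⟩
  have hne' : R'.Nonempty := hne.mono hRR'
  -- hybrids: a tuple of `R` on the unit of `m`, the identity elsewhere, lies in `R'`
  have hhyb : ∀ (m : Fin r) (π : PermsG n), π ∈ R → (fun m' => if U m' = U m then π m' else 1) ∈ R' := by
    intro m π hπ
    rw [hmemR']
    intro m₀
    by_cases hm₀ : U m₀ = U m
    · refine ⟨π, hπ, fun m' hm' => ?_⟩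
      simp only [hm'.trans hm₀, if_true]
    · refine ⟨1, h1R, fun m' hm' => ?_⟩
      have : U m' ≠ U m := fun h => hm₀ (hm'.symm.trans h)
      simp only [this, if_false, Pi.one_apply]
  have hdiag' : ∀ π ∈ R', ∀ (m m' : Fin r) (h : U m' = U m) (a : Fin (n m')), Fin.cast (hn m m' h) (π m' a) = π m (Fin.cast (hn m m' h) a) := by
    intro π hπ m m' h a
    obtain ⟨ρ, hρ, hρe⟩ := (hmemR' π).1 hπ m
    rw [← hρe m rfl, ← hρe m' h]
    exact hdiag ρ hρ m m' h a
  -- movers are FREE in `R'`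
  have hstab' : ∀ (m₀ m : Fin r), U m₀ ≠ U m → ∀ a a' : Fin (n m), ∃ ν ∈ R', (∀ m', U m' = U m₀ → ν m' = 1) ∧ ν m a = a' := by
    intro m₀ m hU a a'
    obtain ⟨π, hπ, hπa⟩ := htrans m a a'
    refine ⟨fun m' => if U m' = U m then π m' else 1, hhyb m π hπ, fun m' hm' => ?_, ?_⟩
    · have : U m' ≠ U m := fun h => hU (hm'.symm.trans h)
      simp only [this, if_false]
    · simp only [if_true, hπa]
  -- balancedness transfers to `R'` (§2)
  have hT' : ModelBalancedG P R' v T := fun π' hπ' =>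
    balancedG_of_signed v (signed_transfer_units_ranked (P := P) U hmul hinv hne htrans rk hrk hpair (fun π hπ => signed_of_modelBalancedG R v hT hπ) π'
      ((hmemR' π').1 hπ'))
  -- the separated-units defect law on `R'` (a unit's separation over `R` gives it over `R' ⊇ R`)
  exact exists_hasDefectsG_of_unitsSeparated hmul' hinv' hne' (fun m a a' => by obtain ⟨π, hπ, h⟩ := htrans m a a'; exact ⟨π, hRR' hπ, h⟩) U hn hdiag' hstab'
    (fun m hm => by
      rcases hkind m hm with h | h | ⟨h, hQ⟩
      · exact Or.inl h
      · exact Or.inr (Or.inl h)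
      · exact Or.inr (Or.inr ⟨h, fun Q hQc => by obtain ⟨π, hπ, e⟩ := hQ Q hQc; exact ⟨π, hRR' hπ, e⟩⟩))
    (fun m hm u w hw => hunit m hm u w fun π hπ => hw π (hRR' hπ)) c hc v T hT'

end Model

/-! ## §2 The realised reading -/

section Realised

variable {I : Type} {r : ℕ} {Kf : I → Type} [∀ i, Field (Kf i)] [∀ i, NumberField (Kf i)] {i₀ : I} {is : Fin r → I} {n : Fin r → ℕ}
  {e : ∀ m : Fin r, (Kf (is m) →+* ℂ) ≃ Fin (n m) × Bool} {τ : Kf i₀ →+* ℂ} {im : ∀ m : Fin r, Kf i₀ →+* Kf (is m)}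
  (he_sign : ∀ (m : Fin r) (s : Kf (is m) →+* ℂ), (e m s).2 = true ↔ s.comp (im m) = τ)

include he_sign in
/-- **THE DEFECT LAW FOR REALISED TUPLES WITH RANKED SEPARATED UNITS** (D2's `exists_hasDefectsG_realisedTuples_of_unitsRanked` with `2`-transitivity + independence on the
units replaced by the abstract separation property `hunit`). [cite: MoonenZarhin1995Duke, Thm. 2.4] [cite: Shimura1998, §18.2 Lemma (i)]
[cite: Serre1977, §2.2 Cor. 2–3 of Prop. 4; §2.3 Ex. 2.6] [cite: DixonMortimer1996, §1.4 Ex. 1.4.1–1.4.2; §1.6 and Thm. 1.6A; §2.1] [cite: Lang2002, XIII §4] -/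
theorem exists_hasDefectsG_realisedTuples_of_unitsRankedSeparated
    (U : Fin r → Fin r) (hn : ∀ m m' : Fin r, U m' = U m → n m' = n m)
    (hdiag : ∀ π ∈ realisedTuples e τ, ∀ (m m' : Fin r) (h : U m' = U m) (a : Fin (n m')), Fin.cast (hn m m' h) (π m' a) = π m (Fin.cast (hn m m' h) a))
    (rk : Fin r → ℕ) (hrk : ∀ m m' : Fin r, U m' = U m → rk m' = rk m)
    (hpair : ∀ m₀ m : Fin r, U m ≠ U m₀ → rk m ≤ rk m₀ →
      (∀ a a' : Fin (n m), ∃ ν ∈ realisedTuples e τ, (∀ m', U m' = U m₀ → ν m' = 1) ∧ ν m a = a') ∨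
      (∀ m', U m' = U m₀ → (∀ a a' b b' : Fin (n m'), a ≠ a' → b ≠ b' → ∃ π ∈ realisedTuples e τ, π m' a = b ∧ π m' a' = b') ∧ n m < n m'))
    {P : ∀ m : Fin r, Finset (Fin (n m))}
    (hkind : ∀ m, (∀ m', U m' = U m → m' = m) → ((n m).Prime ∧ (P m).Nonempty ∧ (P m).card < n m) ∨ (P m).card = 1 ∨
      ((0 < (P m).card ∧ (P m).card < n m) ∧ ∀ Q : Finset (Fin (n m)), Q.card = (P m).card → ∃ π ∈ realisedTuples e τ, preG (π m) (P m) = Q))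
    (hunit : ∀ m, (∃ m', m' ≠ m ∧ U m' = U m) → ∀ (u : {m' : Fin r // U m' = U m} → Fin (n m) → ℤ) (w : ℤ),
      (∀ π ∈ realisedTuples e τ, (∑ i, ∑ x : Fin (n m), (if π m x ∈ (P i.1).image (Fin.cast (hn m i.1 i.2)) then u i x else -u i x)) = w) →
      ∀ (i : {m' : Fin r // U m' = U m}) (a b : Fin (n m)), u i a = u i b)
    (c : Fin r → ℕ) (hc : ∀ m, ((c m : ℕ) : ℤ) = (n m : ℤ) - 2 * (P m).card)
    {α : Type} (v : α → PtG n) (T : Finset α) (hT : ModelBalancedG P (realisedTuples e τ) v T) : ∃ t : Fin r → ℤ, HasDefectsG c v T t :=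
  exists_hasDefectsG_of_unitsRankedSeparated (fun _ hπ _ hπ' => mul_mem_realisedTuples e τ hπ hπ') (fun _ hπ => inv_mem_realisedTuples hπ)
    (realisedTuples_nonempty (e := e) he_sign) (fun m a b => transitive_realisedTuples (e := e) he_sign m a b) U hn hdiag rk hrk hpair hkind hunit c hc v T hT

end Realised

/-! ## §3 The frame headline -/

section Headline

variable {I : Type} {r : ℕ} {Kf : I → Type} [∀ i, Field (Kf i)] [∀ i, NumberField (Kf i)] [∀ i, IsCMField (Kf i)]
  {i₀ : I} {is : Fin r → I} {n : Fin r → ℕ} {τ : Kf i₀ →+* ℂ}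
  {A : Fin (r + 1) → AbelianVariety ℂ} {Φ : ∀ j : Fin (r + 1), CMType (Kf (mfSlots i₀ is j))}
  {ι : ∀ j, 𝓞 (Kf (mfSlots i₀ is j)) →+* End (A j)}
  {θ : ∀ j, Kf (mfSlots i₀ is j) →+* Module.End ℂ (complexBetti (A j).X 1)}

/-- **HEADLINE (frame form) — RANKED SEPARATED UNITS WITH THE SLOT MENU ON THE SINGLE SLOTS, GIVEN THE SINGLE-SLOT WEIL SPACES.**  D3's
`hodgeConjectureFor_biproduct_comp_of_unitsRanked_frames` with `2`-transitivity + independence on the units of two or more slots replaced by the ABSTRACT SEPARATION PROPERTY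
`hunit`; the ranked cross-unit hypothesis `hpair` is unchanged (its second alternative still needs the upper unit `2`-transitive with more letters — decoupling; a dihedral decic
unit therefore takes movers).  `HC_CM` is NOT asserted.
[cite: Pohlmann1968, Thm 1] [cite: MoonenZarhin1995Duke, Thm. 2.4] [cite: Milne2020HodgeClassesAV, 1.2 (a) and Thm. 1] [cite: Serre1977, §2.2 Cor. 2–3 of Prop. 4; §2.3 Ex. 2.6]
[cite: DixonMortimer1996, §1.4 Ex. 1.4.1–1.4.2; §1.6 and Thm. 1.6A; §2.1] [cite: Lang2002, XIII §4] -/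
theorem hodgeConjectureFor_biproduct_comp_of_unitsRankedSeparated_frames (P : ∀ m : Fin r, Finset (Fin (n m))) (p : Fin r → ℕ)
    (hcard : ∀ m, (P m).card = p m) (hp0 : ∀ m, 0 < p m) (hpn : ∀ m, 2 * p m ≤ n m)
    {N : ℕ} (κ : Fin N → Fin (r + 1)) (h2 : Module.finrank ℚ (Kf i₀) = 2) (im : ∀ m : Fin r, Kf i₀ →+* Kf (is m))
    {δ : 𝓞 (Kf i₀)} {d : ℕ} (hτ : τ (δ : Kf i₀) = Complex.I * (Real.sqrt d : ℂ))
    (hA : ∀ j, IsCMTypeRealisation (Φ j) (A j) (ι j) (θ j))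
    (e : ∀ m : Fin r, (Kf (is m) →+* ℂ) ≃ Fin (n m) × Bool)
    (he_sign : ∀ (m : Fin r) (s : Kf (is m) →+* ℂ), (e m s).2 = true ↔ s.comp (im m) = τ)
    (he_conj : ∀ (m : Fin r) (s : Kf (is m) →+* ℂ), e m (ComplexEmbedding.conjugate s) = ((e m s).1, !(e m s).2))
    (hΨ : ∀ σ : Kf i₀ →+* ℂ, σ ∈ (Φ 0).1 ↔ σ = τ)
    (hΦ : ∀ (m : Fin r) (s : Kf (is m) →+* ℂ), s ∈ (Φ m.succ).1 ↔ (e m s).2 = decide ((e m s).1 ∈ P m))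
    (U : Fin r → Fin r) (hn : ∀ m m' : Fin r, U m' = U m → n m' = n m)
    (hdiag : ∀ π ∈ realisedTuples e τ, ∀ (m m' : Fin r) (h : U m' = U m) (a : Fin (n m')), Fin.cast (hn m m' h) (π m' a) = π m (Fin.cast (hn m m' h) a))
    (rk : Fin r → ℕ) (hrk : ∀ m m' : Fin r, U m' = U m → rk m' = rk m)
    (hpair : ∀ m₀ m : Fin r, U m ≠ U m₀ → rk m ≤ rk m₀ →
      (∀ a a' : Fin (n m), ∃ ν ∈ realisedTuples e τ, (∀ m', U m' = U m₀ → ν m' = 1) ∧ ν m a = a') ∨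
      (∀ m', U m' = U m₀ → (∀ a a' b b' : Fin (n m'), a ≠ a' → b ≠ b' → ∃ π ∈ realisedTuples e τ, π m' a = b ∧ π m' a' = b') ∧ n m < n m'))
    (hunit : ∀ m, (∃ m', m' ≠ m ∧ U m' = U m) → ∀ (u : {m' : Fin r // U m' = U m} → Fin (n m) → ℤ) (w : ℤ),
      (∀ π ∈ realisedTuples e τ, (∑ i, ∑ x : Fin (n m), (if π m x ∈ (P i.1).image (Fin.cast (hn m i.1 i.2)) then u i x else -u i x)) = w) →
      ∀ (i : {m' : Fin r // U m' = U m}) (a b : Fin (n m)), u i a = u i b)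
    (hkind : ∀ m : Fin r, (∀ m', U m' = U m → m' = m) → (n m).Prime ∨ p m = 1 ∨
      ∀ Q : Finset (Fin (n m)), Q.card = p m → ∃ π ∈ realisedTuples e τ, preG (π m) (P m) = Q)
    (hW : ∀ m : Fin r, weilClassesOf (⨁ fun i => A (partSlots (n m - 2 * p m) m i))
      (biproduct.map fun i => ι (partSlots (n m - 2 * p m) m i) (δfam im δ (partSlots (n m - 2 * p m) m i))) (n m - p m) d ≤
      algebraicClasses (⨁ fun i => A (partSlots (n m - 2 * p m) m i)).X (n m - p m)) :
    HodgeConjectureFor (⨁ fun j => A (κ j)).dim (⨁ fun j => A (κ j)).X :=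
  hodgeConjectureFor_biproduct_comp_of_defectLawG (is := is) P (fun m => n m - 2 * p m) (fun m => n m - p m)
    (fun m => by have := hpn m; omega) (fun m => by have := hp0 m; have := hpn m; omega) κ h2 im hτ hA e he_sign he_conj hΨ hΦ
    (fun v T hT => exists_hasDefectsG_realisedTuples_of_unitsRankedSeparated (e := e) he_sign U hn hdiag rk hrk hpair
      (fun m hsingle => by
        rcases hkind m hsingle with hpr | h1 | hhom
        · exact Or.inl ⟨hpr, Finset.card_pos.1 (by rw [hcard m]; exact hp0 m), by have := hpn m; have := hp0 m; rw [hcard m]; omega⟩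
        · exact Or.inr (Or.inl (by rw [hcard m, h1]))
        · exact Or.inr (Or.inr ⟨⟨by rw [hcard m]; exact hp0 m, by have := hpn m; have := hp0 m; rw [hcard m]; omega⟩,
            fun Q hQ => hhom Q (by rw [hQ, hcard m])⟩))
      hunit (fun m => n m - 2 * p m) (cast_sub_two_mul_eq hcard hpn) v T hT) hW

end Headline

/-! ## §4 The old hypotheses give the separation property -/

section TwoTransitive

variable {r : ℕ} {n : Fin r → ℕ} {R : Finset (PermsG n)} {P : ∀ m : Fin r, Finset (Fin (n m))}

/-- **`2`-TRANSITIVITY + LINEAR INDEPENDENCE ⟹ THE SEPARATION PROPERTY** (U1 `const_of_signed_unit_of_linearIndependent` read through the image of `R` at the slot `m`): the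
hypotheses `h2t`, `hli` of D2/U2 at a unit give the hypothesis `hunit` of the separated engines — so `2`-transitive units and dihedral decic units (`…DihedralUnit`) live in ONE
menu. [cite: DixonMortimer1996, §1.4 Ex. 1.4.1–1.4.2; §2.1] [cite: Lang2002, XIII §4] -/
theorem unit_separated_of_twoTransitive (hmul : ∀ π ∈ R, ∀ π' ∈ R, π * π' ∈ R) (U : Fin r → Fin r) (hn : ∀ m m' : Fin r, U m' = U m → n m' = n m) (m : Fin r)
    (h2t : ∀ a a' b b' : Fin (n m), a ≠ a' → b ≠ b' → ∃ π ∈ R, π m a = b ∧ π m a' = b')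
    (hli : LinearIndependent ℚ fun m' : {m' : Fin r // U m' = U m} => fun q : Fin (n m) =>
      ((n m : ℚ) * (if q ∈ (P m'.1).image (Fin.cast (hn m m'.1 m'.2)) then 1 else 0) - (P m'.1).card))
    (u : {m' : Fin r // U m' = U m} → Fin (n m) → ℤ) (w : ℤ)
    (h : ∀ π ∈ R, (∑ i, ∑ x : Fin (n m), (if π m x ∈ (P i.1).image (Fin.cast (hn m i.1 i.2)) then u i x else -u i x)) = w)
    (i : {m' : Fin r // U m' = U m}) (a b : Fin (n m)) : u i a = u i b := by
  let H : Finset (Equiv.Perm (Fin (n m))) := R.image fun π => π m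
  have hH : ∀ σ, σ ∈ H ↔ ∃ π ∈ R, π m = σ := fun σ => Finset.mem_image
  have hmulH : ∀ σ ∈ H, ∀ σ' ∈ H, σ * σ' ∈ H := by
    intro σ hσ σ' hσ'
    obtain ⟨π, hπ, rfl⟩ := (hH σ).1 hσ
    obtain ⟨π', hπ', rfl⟩ := (hH σ').1 hσ'
    exact (hH _).2 ⟨π * π', hmul _ hπ _ hπ', rfl⟩
  have h2tH : ∀ a a' b b' : Fin (n m), a ≠ a' → b ≠ b' → ∃ σ ∈ H, σ a = b ∧ σ a' = b' := by
    intro a a' b b' haa hbb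
    obtain ⟨π, hπ, hb, hb'⟩ := h2t a a' b b' haa hbb
    exact ⟨π m, (hH _).2 ⟨π, hπ, rfl⟩, hb, hb'⟩
  have hw : ∀ σ ∈ H, (∑ i, ∑ x : Fin (n m), (if σ x ∈ (P i.1).image (Fin.cast (hn m i.1 i.2)) then u i x else -u i x)) = w := by
    intro σ hσ
    obtain ⟨π, hπ, rfl⟩ := (hH σ).1 hσ
    exact h π hπ
  have hli' : LinearIndependent ℚ fun i : {m' : Fin r // U m' = U m} => fun q : Fin (n m) =>
      ((n m : ℚ) * (if q ∈ (P i.1).image (Fin.cast (hn m i.1 i.2)) then 1 else 0) - ((P i.1).image (Fin.cast (hn m i.1 i.2))).card) := by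
    have hfun : (fun i : {m' : Fin r // U m' = U m} => fun q : Fin (n m) =>
        ((n m : ℚ) * (if q ∈ (P i.1).image (Fin.cast (hn m i.1 i.2)) then 1 else 0) - ((P i.1).image (Fin.cast (hn m i.1 i.2))).card)) =
        fun i : {m' : Fin r // U m' = U m} => fun q : Fin (n m) => ((n m : ℚ) * (if q ∈ (P i.1).image (Fin.cast (hn m i.1 i.2)) then 1 else 0) - (P i.1).card) := by
      funext i q
      rw [Finset.card_image_of_injective _ (Fin.cast_injective _)]
    rw [hfun]
    exact hli
  exact const_of_signed_unit_of_linearIndependent hmulH h2tH (fun i : {m' : Fin r // U m' = U m} => (P i.1).image (Fin.cast (hn m i.1 i.2))) u hw hli' i a b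

end TwoTransitive

end Summit.HodgeConjecture.CorCM.MultiFieldWeil

end
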